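import Literature.Barriers.CriticalPhenomena.RigorousRGSmallParameterLocOperator
import Literature.Barriers.CriticalPhenomena.RigorousRGSmallParameterLocLocality
import HarnessLib

/-!
# `RigorousRGSmallParameter` (Slade, Theorem 1.4.1): properties of the localisation operator —
# independence from the base point of the patch (Proposition 1.3.1 (iii) of [BS-rg-loc]),
# Propositions 1.4.1–1.4.2, and `Loc_{X,Y}` (Definition 1.7.1)

Companion ("proof architecture") file of
`Literature/Barriers/CriticalPhenomena/RigorousRGSmallParameter.lean`, continuing `…LocOperator`
(`Loc_X`, Definition 1.3.2, with Proposition 1.3.1 (i)–(ii) for the dual basis at a base point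
`a`) and `…LocLocality` (`𝒩(U)`, symmetry of pairings). [BS-rg-loc] state that the polynomial
`V = Loc_X F` "does not depend on the choice of coordinate `z` or coordinate patch"
(Proposition 1.3.1 (iii)); that `Loc_X ∘ Loc_{X'} = Loc_X` (Proposition 1.4.1) and the
additivity `Loc_X(Σ_x F_x) = P(X)` when `Loc_{{x}}F_x = P_x` (Proposition 1.4.2); and define
`Loc_{X,Y}F = P_X(Y)` (Definition 1.7.1) with `Loc_X = Σ_i Loc_{X,X_i}` over partitions. This file
proves these for the concrete model on the torus `TorusSite d M`:

* **Change of base point (Chu–Vandermonde).** For `a' = a + w`, inside the common patch,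
  `b^{(a')}_{(i,t)} = Σ_{s ≤ t} (∏_j binom(-w_j, t_j-s_j)) b^{(a)}_{(i,s)}` (`binomV_base_change`),
  so an `H ∈ 𝒩(U)` pairing to zero with all `f_C^{(a)}`, `C ∈ 𝔳_+`, pairs to zero with all
  `f_C^{(a')}` (`TphiPairing_dualC_baseChange_eq_zero`: expand factor by factor, the expansion only
  lowers dimensions, and rearranged products pair alike); with uniqueness at `a'` this gives
  **`locX_base_change`**: `Loc_X^{(a')}F = Loc_X^{(a)}F` for `F ∈ 𝒩(U)`.
* **Field locality of the range**: monomials of order `≤ K` at `x` lie in `𝒩(reach(x,K))`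
  (`dependsOn_monomial`), hence `P̂_m(X)`, `Loc_X F ∈ 𝒩(U)` when `U ⊇ reach(x, ⌊d_+⌋)` for
  `x ∈ X` (`dependsOn_phatX`, `dependsOn_locX`) — the role of `X^{(1)}` and `𝒩_X` in [BS-rg-loc].
* **Proposition 1.4.1** (`locX_locX'`), **Proposition 1.4.2** (`locX_sum_eq`), **Definition 1.7.1**
  (`locXY`, `locXY_self`, `locX_eq_sum_locXY_singleton`, `locXY_union`).

Scope: Euclidean covariance (Propositions 1.4.3–1.4.4) and the norm estimates
(Propositions 1.4.5, 1.5.1, 1.7.2) are not in this file.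

Sources: D. C. Brydges, G. Slade, *A renormalisation group method. II. Approximation by local
polynomials*, J. Stat. Phys. 159 (2015) 461–491, arXiv:1403.7253 (read from the TeX source:
§1.3 (Proposition 1.3.1, `X^{(1)}`, coordinates), §1.4 (Propositions 1.4.1, 1.4.2), §1.7
(Definition 1.7.1 and the following display), §2.1 ((2.3) and "for any `a ∈ Λ'` the set
`{b^{(a)}_m}` is a basis for `Π`"; proof of Proposition 1.3.1 (iii))).

## What this file provides (definitions with proved properties; no named fact)

* `binomV`, `binomTF_eq_binomV`, `listOfCounts` (+`count_`, `length_`), `binomV_eq_binomTF`,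
  `binomTF_eq_of_cls_eq`, `coord_offsetPtZ_base`, **`binomV_base_change`**.
* `reach`, `mem_reach`, `mem_reach_self`, `reach_mono`, `reach_step_subset`, `dependsOn_dfield`,
  **`dependsOn_monomial`**, `dependsOn_phatX`, **`dependsOn_locX`**.
* `wt`, `wt_cons`, `bcls`, `binomTF_eq_bcls_cls`, `TphiPairing_tensorTF_binomV_eq_zero`,
  `ExpFactor` (a one-point function with a binomial expansion `Valid` on `U`),
  **`TphiPairing_tensorTF_expand_eq_zero`** (span stability for products of expandable factors),
  `baseChangeFactor`, `baseChangeFactor_valid`, **`TphiPairing_dualC_baseChange_eq_zero`**,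
  `TphiPairing_sub`, `locX_congr_of_alphaVec_eq`, **`locX_base_change`** (Proposition 1.3.1 (iii)).
* **`locX_locX'`** (Proposition 1.4.1), `phatX_eq_sum_singleton`, **`locX_sum_eq`**
  (Proposition 1.4.2), **`locXY`** (Definition 1.7.1), `locXY_self`,
  `locX_eq_sum_locXY_singleton`, `locXY_union`.

## References

* [BrydgesSlade2015RGII] D. C. Brydges, G. Slade, *A renormalisation group method. II.
  Approximation by local polynomials*, J. Stat. Phys. 159 (2015) 461–491, arXiv:1403.7253 —
  §1.3, §1.4, §1.7, §2.1.
* [Slade2017] G. Slade, *Critical exponents for long-range O(n) models below the upper critical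
  dimension*, Commun. Math. Phys. 358 (2018) 343–436, arXiv:1611.06169 — §4.2 (Loc).
-/

noncomputable section

namespace Literature.Barriers.CriticalPhenomena

namespace LongRangePhi4

namespace Loc

open Finset Tphi RGNorm LocalPoly Polymer Literature.Probability.LatticeModels Matrix
open scoped ContDiff

variable {d M n : ℕ} [NeZero M]

/-! ### The binomial one-point functions in count-vector form -/

/-- `b^{(a)}_{(i,t)}(x,i') = 𝟙{i'=i}∏_j binom(z_j(x), t_j)` for a count vector `t ∈ ℕ^d`
(`binomTF a (i, α) = binomV a i (count α)`). [cite: BrydgesSlade2015RGII, §2.1 (display (2.3))] -/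
def binomV (a : TorusSite d M) (i : Fin n) (t : Fin d → ℕ) : TorusSite d M × Fin n → ℝ :=
  fun y => if y.2 = i then ∏ j : Fin d, ((Ring.choose (coord a y.1 j) (t j) : ℤ) : ℝ) else 0

omit [NeZero M] in
/-- `binomTF` in count-vector form. [folklore] -/
theorem binomTF_eq_binomV (a : TorusSite d M) (c : Fin n × List (Fin d)) :
    binomTF a c = binomV a c.1 (fun j => c.2.count j) := rfl

/-- A list of directions with prescribed counts. [folklore] -/
def listOfCounts (t : Fin d → ℕ) : List (Fin d) := (List.ofFn fun j => List.replicate (t j) j).flatten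

omit [NeZero M] in
/-- The counts of `listOfCounts t` are `t`. [folklore] -/
theorem count_listOfCounts (t : Fin d → ℕ) (j : Fin d) : (listOfCounts t).count j = t j := by
  unfold listOfCounts
  rw [List.count_flatten, List.map_ofFn, List.sum_ofFn]
  simp only [Function.comp_apply, List.count_replicate, beq_iff_eq]
  rw [Finset.sum_eq_single j]
  · simp
  · intro k _ hk; simp [hk]
  · intro h; exact absurd (Finset.mem_univ j) h

omit [NeZero M] in
/-- The length of `listOfCounts t` is `Σ_j t_j`. [folklore] -/
theorem length_listOfCounts (t : Fin d → ℕ) : (listOfCounts t).length = ∑ j, t j := by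
  unfold listOfCounts
  rw [List.length_flatten, List.map_ofFn, List.sum_ofFn]
  simp

omit [NeZero M] in
/-- `binomV a i t = binomTF a (i, listOfCounts t)`. [folklore] -/
theorem binomV_eq_binomTF (a : TorusSite d M) (i : Fin n) (t : Fin d → ℕ) :
    binomV a i t = binomTF a (i, listOfCounts t) := by
  rw [binomTF_eq_binomV]
  simp only [count_listOfCounts]

omit [NeZero M] in
/-- `binomTF a c` depends on `c` only through its class. [folklore] -/
theorem binomTF_eq_of_cls_eq (a : TorusSite d M) {c c' : Fin n × List (Fin d)} (h : cls c = cls c') :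
    binomTF a c = binomTF a c' := by
  rw [cls_eq_cls_iff] at h
  rw [binomTF_eq_binomV, binomTF_eq_binomV, h.1]
  congr 1
  funext j
  exact h.2.count_eq j

/-! ### Coordinates and binomials under a change of base point (Chu–Vandermonde) -/

/-- **Coordinates relative to `a' = a + w`**: `z^{(a')}_j(y) = z^{(a)}_j(y) - w_j` inside the patch. [cite: BrydgesSlade2015RGII, §1.3 ("if z and z̃ are both coordinates … z̃ = Ez")] -/
theorem coord_offsetPtZ_base (a : TorusSite d M) (w : Fin d → ℤ) (y : TorusSite d M) (j : Fin d)
    (h : 2 * |coord a y j - w j| < M) : coord (offsetPtZ a w) y j = coord a y j - w j := by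
  unfold coord at h
  unfold coord offsetPtZ
  set c : ℤ := (y j - a j).valMinAbs with hcdef
  have hc : (y j - a j : ZMod M) = ((c : ℤ) : ZMod M) := by rw [hcdef, ZMod.coe_valMinAbs]
  have e : y j - (a j + ((w j : ℤ) : ZMod M)) = ((c - w j : ℤ) : ZMod M) := by
    rw [Int.cast_sub, ← hc]; ring
  rw [e, ZMod.valMinAbs_spec]
  refine ⟨rfl, ?_, ?_⟩
  · have := neg_abs_le (c - w j); omega
  · have := le_abs_self (c - w j); omega

/-- **Change of base point for the binomial one-point functions (Chu–Vandermonde)**: inside the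
patch, `b^{(a+w)}_{(i,t)} = Σ_{s ≤ t} (∏_j binom(-w_j, t_j - s_j)) b^{(a)}_{(i,s)}` — the binomials
based at `a'` are polynomials of the same degree, hence combinations of those based at `a` ("for any
`a ∈ Λ'`, the set `{b^{(a)}_m}` is a basis for `Π`"). [cite: BrydgesSlade2015RGII, §2.1 (sentence after display (2.3))] -/
theorem binomV_base_change (a : TorusSite d M) (w : Fin d → ℤ) (i : Fin n) (t : Fin d → ℕ)
    (y : TorusSite d M × Fin n) (hy : ∀ j, 2 * |coord a y.1 j - w j| < M) :
    binomV (offsetPtZ a w) i t y =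
      ∑ s ∈ Fintype.piFinset (fun j => range (t j + 1)),
        (∏ j : Fin d, ((Ring.choose (-(w j)) (t j - s j) : ℤ) : ℝ)) * binomV a i s y := by
  unfold binomV
  by_cases hi : y.2 = i
  · simp only [hi, if_true]
    have hfac : ∀ j, ((Ring.choose (coord (offsetPtZ a w) y.1 j) (t j) : ℤ) : ℝ) =
        ∑ p ∈ range (t j + 1), ((Ring.choose (coord a y.1 j) p : ℤ) : ℝ) * ((Ring.choose (-(w j)) (t j - p) : ℤ) : ℝ) := by
      intro j
      rw [coord_offsetPtZ_base a w y.1 j (hy j), sub_eq_add_neg,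
        Ring.add_choose_eq (t j) (Commute.all _ _), ← Finset.Nat.sum_antidiagonal_eq_sum_range_succ
          (fun p q => ((Ring.choose (coord a y.1 j) p : ℤ) : ℝ) * ((Ring.choose (-(w j)) q : ℤ) : ℝ))]
      push_cast
      rfl
    simp only [hfac]
    rw [Finset.prod_univ_sum]
    refine Finset.sum_congr rfl fun s _ => ?_
    rw [Finset.prod_mul_distrib, mul_comm]
  · simp [hi]

/-! ### The reach of a monomial and field locality of `P̂_m(X)`, `Loc_X F` -/

/-- The points within `ℓ^∞` coordinate distance `K` of `x` (the support of monomials of order `≤ K`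
at `x`; `X^{(1)}` of [BS-rg-loc] for `K = p̄_Φ`). [cite: BrydgesSlade2015RGII, §1.3 (definition of X^{(1)})] -/
def reach (x : TorusSite d M) (K : ℕ) : Finset (TorusSite d M) := univ.filter fun y => ∀ j, |coord x y j| ≤ K

/-- Membership in the reach. [folklore] -/
theorem mem_reach {x y : TorusSite d M} {K : ℕ} : y ∈ reach x K ↔ ∀ j, |coord x y j| ≤ K := by
  simp [reach]

/-- `x ∈ reach x K`. [folklore] -/
theorem mem_reach_self (x : TorusSite d M) (K : ℕ) : x ∈ reach x K := by
  rw [mem_reach]; intro j; simp [coord, ZMod.valMinAbs_zero]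

/-- The reach is monotone in the radius. [folklore] -/
theorem reach_mono (x : TorusSite d M) {K K' : ℕ} (h : K ≤ K') : reach x K ⊆ reach x K' := by
  intro y hy; rw [mem_reach] at hy ⊢; exact fun j => (hy j).trans (by exact_mod_cast h)

/-- A unit step enlarges the reach by one: `reach(x ± e_j, K) ⊆ reach(x, K+1)` (no wrapping). [folklore] -/
theorem reach_step_subset (x : TorusSite d M) (s : Fin d × Bool) {K : ℕ} (hK : 2 * ((K : ℤ) + 1) < M) :
    reach (x + unitStep d M s) K ⊆ reach x (K + 1) := by
  intro y hy
  rw [mem_reach] at hy ⊢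
  intro j
  set w : Fin d → ℤ := fun j' => if j' = s.1 then (if s.2 then -1 else 1) else 0 with hw
  have hx : x = offsetPtZ (x + unitStep d M s) w := by
    funext j'
    simp only [offsetPtZ, hw, unitStep, Pi.add_apply]
    by_cases h : j' = s.1
    · subst h; cases s.2 <;> simp
    · simp [h]
  have hwj : |w j| ≤ 1 := by
    simp only [hw]; split_ifs <;> simp
  have hb : 2 * |coord (x + unitStep d M s) y j - w j| < M := by
    have := hy j
    have h3 := abs_sub (coord (x + unitStep d M s) y j) (w j)
    omega
  rw [hx, coord_offsetPtZ_base _ w y j hb]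
  have := hy j
  have h3 := abs_sub (coord (x + unitStep d M s) y j) (w j)
  push_cast
  omega

/-- **`∇^α φ^i_x` depends on the field in `reach(x, |α|)` only.** [folklore] -/
theorem dependsOn_dfield : ∀ (l : List (Fin d × Bool)) (x : TorusSite d M) (i : Fin n),
    2 * ((l.length : ℤ) + 1) < M → DependsOn (reach x l.length) (fun φ => dfield l (x, i) φ)
  | [], x, i, _ => fun φ ψ h => by simpa using congrFun (h x (mem_reach_self x 0)) i
  | s :: l, x, i, hM => by
      intro φ ψ h
      simp only [dfield_cons]
      have hl : 2 * ((l.length : ℤ) + 1) < M := by simp at hM; omega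
      have h1 := dependsOn_dfield l (x + unitStep d M s) i hl φ ψ fun y hy =>
        h y (reach_step_subset x s hl (by simpa using hy))
      have h2 := dependsOn_dfield l x i hl φ ψ fun y hy =>
        h y (reach_mono x (by simp) hy)
      simp only [] at h1 h2
      rw [h1, h2]

/-- **Monomials of order `≤ K` at `x` lie in `𝒩(reach(x,K))`.** [folklore] -/
theorem dependsOn_monomial (x : TorusSite d M) {K : ℕ} (hK : 2 * ((K : ℤ) + 1) < M) :
    ∀ (m'' : List (Fin n × List (Fin d × Bool))), (∀ c ∈ m'', c.2.length ≤ K) →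
    DependsOn (reach x K) (monomial m'' x)
  | [], _ => by rw [monomial_nil]; exact fun _ _ _ => rfl
  | c :: m'', hm => by
      rw [monomial_cons]
      refine DependsOn.mul ?_ (dependsOn_monomial x hK m'' fun c' hc' => hm c' (List.mem_cons_of_mem _ hc'))
      have hc := hm c List.mem_cons_self
      exact (dependsOn_dfield c.2 x c.1 (by omega)).mono (reach_mono x hc)

/-- **`P̂_m(X) ∈ 𝒩(U)` when `U` contains the reach of every point of `X`.** [folklore] -/
theorem dependsOn_phatX {U X : Finset (TorusSite d M)} {K : ℕ} (hK : 2 * ((K : ℤ) + 1) < M)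
    (hXU : ∀ x ∈ X, reach x K ⊆ U) (m' : List (Fin n × List (Fin d))) (hm : ∀ c ∈ m', c.2.length ≤ K) :
    DependsOn U (phatX m' X) := by
  unfold phatX phat
  refine DependsOn.sum fun x hx => DependsOn.mul (fun _ _ _ => rfl) (DependsOn.sum fun S _ => ?_)
  refine DependsOn.mul (fun _ _ _ => rfl) ((dependsOn_monomial x hK _ fun c hc => ?_).mono (hXU x hx))
  simp only [flipM, fwd, List.map_map, List.mem_map, Function.comp_apply] at hc
  obtain ⟨c₀, hc₀, rfl⟩ := hc
  simpa using hm c₀ hc₀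

/-- **`Loc_X F ∈ 𝒩(U)` when `U` contains the reach `⌊d_+⌋` of every point of `X`.** [folklore] -/
theorem dependsOn_locX {pN : ℕ} {dφ dplus : ℝ} (hφ : 0 < dφ) {U X : Finset (TorusSite d M)}
    (hK : 2 * ((⌊dplus⌋₊ : ℤ) + 1) < M) (hXU : ∀ x ∈ X, reach x ⌊dplus⌋₊ ⊆ U) (a : TorusSite d M)
    (F : (TorusSite d M → Fin n → ℝ) → ℝ) : DependsOn U (locX pN dφ dplus a X F) := by
  unfold locX
  refine DependsOn.sum fun C _ => DependsOn.mul (fun _ _ _ => rfl) (dependsOn_phatX hK hXU _ ?_)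
  exact (bounds_of_mem_vbarPlus (rep_mem_vbarPlus hφ C.2)).2

/-! ### Span stability of the dual test functions under a change of base point -/

/-- The weight `|L|·[φ] + Σ_k |t_k|` of a list of (component, count-vector) factors. [folklore] -/
def wt (dφ : ℝ) (L : List (Fin n × (Fin d → ℕ))) : ℝ := L.length * dφ + ((L.map fun q => ∑ j, q.2 j).sum : ℕ)

omit [NeZero M] in
/-- `wt` of a cons. [folklore] -/
theorem wt_cons (dφ : ℝ) (q : Fin n × (Fin d → ℕ)) (L : List (Fin n × (Fin d → ℕ))) :
    wt dφ (q :: L) = wt dφ L + dφ + ((∑ j, q.2 j : ℕ) : ℝ) := by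
  unfold wt
  simp only [List.length_cons, List.map_cons, List.sum_cons, Nat.cast_add, Nat.cast_succ]
  ring

/-- The binomial one-point function of a class. [folklore] -/
def bcls (a : TorusSite d M) (q : Fin n × Multiset (Fin d)) : TorusSite d M × Fin n → ℝ :=
  binomV a q.1 fun j => q.2.count j

omit [NeZero M] in
/-- `binomTF a = bcls a ∘ cls`. [folklore] -/
theorem binomTF_eq_bcls_cls (a : TorusSite d M) (c : Fin n × List (Fin d)) : binomTF a c = bcls a (cls c) := by
  rw [binomTF_eq_binomV]
  simp [bcls, cls, Multiset.coe_count]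

/-- **Base case of the span stability**: an `H ∈ 𝒩` whose zero-field pairings with all dual test
functions `f_C^{(a)}`, `C ∈ 𝔳_+`, vanish pairs to zero with every product of binomials based at
`a` of admissible weight (in any order, with any count vectors). [folklore] -/
theorem TphiPairing_tensorTF_binomV_eq_zero {pN : ℕ} {dφ dplus : ℝ} (hA : LocAdm M n pN dφ dplus) (a : TorusSite d M)
    {H : (TorusSite d M → Fin n → ℝ) → ℝ} (hH : ContDiff ℝ ∞ H)
    (hzero : ∀ C ∈ vPlus d n dφ dplus, TphiPairing pN (basisDir d M n) H 0 (dualC a C) = 0)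
    (L₁ : List (Fin n × (Fin d → ℕ))) (hwt : wt dφ L₁ ≤ dplus) :
    TphiPairing pN (basisDir d M n) H 0 (tensorTF (L₁.map fun q => binomV a q.1 q.2)) = 0 := by
  set m'' : List (Fin n × List (Fin d)) := L₁.map fun q => (q.1, listOfCounts q.2) with hm''
  have hlist : (L₁.map fun q => binomV a q.1 q.2) = m''.map (binomTF a) := by
    rw [hm'', List.map_map]
    refine List.map_congr_left fun q _ => ?_
    simp [Function.comp_apply, binomV_eq_binomTF]
  have hdim : dim dφ m'' = wt dφ L₁ := by
    unfold dim wt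
    rw [hm'', List.length_map, List.map_map]
    congr 2
    exact congrArg List.sum (List.map_congr_left fun q _ => by simp [length_listOfCounts])
  have hmem : m'' ∈ vbarPlus d n dφ dplus := (mem_vbarPlus hA.pos).2 (hdim ▸ hwt)
  set C'' : Multiset (Fin n × Multiset (Fin d)) :=
    ((m''.map cls : List (Fin n × Multiset (Fin d))) : Multiset (Fin n × Multiset (Fin d))) with hC''
  have hC''mem : C'' ∈ vPlus d n dφ dplus := Finset.mem_image.2 ⟨m'', hmem, rfl⟩
  -- the representative of `C''` lists the same factors up to order and per-factor rearrangement
  have hperm : ((rep C'').map (binomTF a)).Perm (m''.map (binomTF a)) := by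
    have h1 : ∀ l : List (Fin n × List (Fin d)), l.map (binomTF a) = (l.map cls).map (bcls a) := by
      intro l; rw [List.map_map]; exact List.map_congr_left fun c _ => binomTF_eq_bcls_cls a c
    rw [h1, h1]
    exact (Multiset.coe_eq_coe.1 (by rw [cls_rep C''])).map _
  have hb := bounds_of_mem_vbarPlus (rep_mem_vbarPlus hA.pos hC''mem)
  have h0 := hzero C'' hC''mem
  unfold dualC dualTF at h0
  unfold TphiPairing at h0
  rw [pairing_smul_right] at h0
  have hK : ((rep C'').length.factorial : ℝ) / pcount (rep C'') (rep C'') ≠ 0 :=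
    div_ne_zero (by positivity) (by have := one_le_pcount_self (rep C''); positivity)
  have h1 : pairing pN (coeffFamily (basisDir d M n) H 0) (tensorTF ((rep C'').map (binomTF a))) = 0 := by
    rcases mul_eq_zero.1 h0 with h | h
    · exact absurd h hK
    · exact h
  rw [hlist]
  have h2 := TphiPairing_tensorTF_of_perm pN hperm hH 0
  unfold TphiPairing at h2
  unfold TphiPairing
  rw [← h2, h1]

/-- A one-point test function `β` (of component `i`) together with an expansion in the binomials
based at `a` of weight `≤ t`: `β = Σ_{s ≤ t} coef(s) b^{(a)}_{(i,s)}` (valid on a set `U`, `Valid`). [folklore] -/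
structure ExpFactor (d M n : ℕ) where
  /-- the one-point test function -/
  β : TorusSite d M × Fin n → ℝ
  /-- its component -/
  i : Fin n
  /-- the bound on the count vectors of the expansion -/
  t : Fin d → ℕ
  /-- the coefficients of the expansion -/
  coef : (Fin d → ℕ) → ℝ

/-- Validity of the expansion on `U`. [folklore] -/
def ExpFactor.Valid (a : TorusSite d M) (U : Finset (TorusSite d M)) (q : ExpFactor d M n) : Prop :=
  ∀ y : TorusSite d M × Fin n, y.1 ∈ U →
    q.β y = ∑ s ∈ Fintype.piFinset (fun j => range (q.t j + 1)), q.coef s * binomV a q.i s y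

/-- The weight `[φ] + |t|` of an expandable factor. [folklore] -/
def ExpFactor.wtq (dφ : ℝ) (q : ExpFactor d M n) : ℝ := dφ + ((∑ j, q.t j : ℕ) : ℝ)

/-- **Span stability (the inductive expansion)**: for `H ∈ 𝒩(U)` pairing to zero with all dual
test functions `f_C^{(a)}`, `C ∈ 𝔳_+`, every product of one-point functions expandable on `U` in
binomials based at `a` (followed by binomials based at `a`) of admissible total weight pairs to
zero with `H`: expand the first factor and move the resulting `a`-factors to the back (the expansion
only lowers weights). Used for the change of base point (Chu–Vandermonde) and for the lattice
symmetries. [cite: BrydgesSlade2015RGII, §2.1 (proof of Proposition 1.3.1 (iii): independence of the coordinate)] -/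
theorem TphiPairing_tensorTF_expand_eq_zero {pN : ℕ} {dφ dplus : ℝ} (hA : LocAdm M n pN dφ dplus)
    (a : TorusSite d M) {U : Finset (TorusSite d M)}
    {H : (TorusSite d M → Fin n → ℝ) → ℝ} (hH : ContDiff ℝ ∞ H) (hHU : DependsOn U H)
    (hzero : ∀ C ∈ vPlus d n dφ dplus, TphiPairing pN (basisDir d M n) H 0 (dualC a C) = 0) :
    ∀ (L₂ : List (ExpFactor d M n)) (L₁ : List (Fin n × (Fin d → ℕ))), (∀ q ∈ L₂, q.Valid a U) →
    wt dφ L₁ + (L₂.map (ExpFactor.wtq dφ)).sum ≤ dplus →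
    TphiPairing pN (basisDir d M n) H 0
      (tensorTF ((L₂.map ExpFactor.β) ++ (L₁.map fun q => binomV a q.1 q.2))) = 0
  | [], L₁, _, hwt => by
      rw [List.map_nil, List.nil_append]
      exact TphiPairing_tensorTF_binomV_eq_zero hA a hH hzero L₁ (by simp at hwt; linarith)
  | q :: L₂, L₁, hval, hwt => by
      rw [List.map_cons, List.cons_append,
        TphiPairing_tensorTF_cons_expand hHU hH pN 0 (Fintype.piFinset fun j => range (q.t j + 1))
          q.coef (fun s => binomV a q.i s) q.β (hval q List.mem_cons_self) _]
      refine Finset.sum_eq_zero fun s hs => ?_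
      rw [Fintype.mem_piFinset] at hs
      have hsle : ∀ j, s j ≤ q.t j := fun j => Nat.lt_succ_iff.1 (Finset.mem_range.1 (hs j))
      -- move the new `a`-factor to the back and apply the induction hypothesis
      have hperm : (binomV a q.i s :: ((L₂.map ExpFactor.β) ++ (L₁.map fun q => binomV a q.1 q.2))).Perm
          ((L₂.map ExpFactor.β) ++ (((q.i, s) :: L₁).map fun q => binomV a q.1 q.2)) := by
        rw [List.map_cons]
        exact List.perm_middle.symm
      rw [TphiPairing_tensorTF_of_perm pN hperm hH 0,
        TphiPairing_tensorTF_expand_eq_zero hA a hH hHU hzero L₂ ((q.i, s) :: L₁)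
          (fun q' hq' => hval q' (List.mem_cons_of_mem _ hq')) ?_, mul_zero]
      rw [wt_cons]
      dsimp only
      rw [List.map_cons, List.sum_cons] at hwt
      have hq : ExpFactor.wtq dφ q = dφ + ((∑ j, q.t j : ℕ) : ℝ) := rfl
      rw [hq] at hwt
      have hsum : ((∑ j, s j : ℕ) : ℝ) ≤ ((∑ j, q.t j : ℕ) : ℝ) := by
        exact_mod_cast Finset.sum_le_sum fun j _ => hsle j
      linarith

/-- The binomials based at `a' = a + w` as expandable factors (Chu–Vandermonde). [folklore] -/
def baseChangeFactor (a : TorusSite d M) (w : Fin d → ℤ) (i : Fin n) (t : Fin d → ℕ) : ExpFactor d M n :=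
  ⟨binomV (offsetPtZ a w) i t, i, t, fun s => ∏ j : Fin d, ((Ring.choose (-(w j)) (t j - s j) : ℤ) : ℝ)⟩

/-- Validity of the Chu–Vandermonde expansion inside the common patch. [folklore] -/
theorem baseChangeFactor_valid (a : TorusSite d M) (w : Fin d → ℤ) {U : Finset (TorusSite d M)}
    (hU : ∀ y ∈ U, ∀ j, 2 * |coord a y j - w j| < M) (i : Fin n) (t : Fin d → ℕ) :
    (baseChangeFactor a w i t).Valid a U :=
  fun y hy => binomV_base_change a w i t y (hU y.1 hy)

/-- **The dual test functions based at `a' = a + w` are spanned, in pairings with `𝒩(U)`, by those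
based at `a`**: if `⟨H, f_C^{(a)}⟩_0 = 0` for all `C ∈ 𝔳_+` then `⟨H, f_C^{(a')}⟩_0 = 0` for all
`C ∈ 𝔳_+`. [cite: BrydgesSlade2015RGII, Proposition 1.3.1 (iii) ("V does not depend on the choice of coordinate z")] -/
theorem TphiPairing_dualC_baseChange_eq_zero {pN : ℕ} {dφ dplus : ℝ} (hA : LocAdm M n pN dφ dplus)
    (a : TorusSite d M) (w : Fin d → ℤ) {U : Finset (TorusSite d M)} (hU : ∀ y ∈ U, ∀ j, 2 * |coord a y j - w j| < M)
    {H : (TorusSite d M → Fin n → ℝ) → ℝ} (hH : ContDiff ℝ ∞ H) (hHU : DependsOn U H)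
    (hzero : ∀ C ∈ vPlus d n dφ dplus, TphiPairing pN (basisDir d M n) H 0 (dualC a C) = 0)
    {C : Multiset (Fin n × Multiset (Fin d))} (hC : C ∈ vPlus d n dφ dplus) :
    TphiPairing pN (basisDir d M n) H 0 (dualC (offsetPtZ a w) C) = 0 := by
  set L₂ : List (ExpFactor d M n) := (rep C).map fun c => baseChangeFactor a w c.1 (fun j => c.2.count j) with hL₂
  have hlist : (rep C).map (binomTF (offsetPtZ a w)) = L₂.map ExpFactor.β := by
    rw [hL₂, List.map_map]
    exact List.map_congr_left fun c _ => by simp [Function.comp_apply, binomTF_eq_binomV, baseChangeFactor]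
  have hdim : dim dφ (rep C) ≤ dplus := (mem_vbarPlus hA.pos).1 (rep_mem_vbarPlus hA.pos hC)
  have heq : (L₂.map (ExpFactor.wtq dφ)).sum = dim dφ (rep C) := by
    unfold dim
    rw [hL₂, List.map_map]
    have h1 : ∀ l : List (Fin n × List (Fin d)),
        (l.map (ExpFactor.wtq dφ ∘ fun c => baseChangeFactor a w c.1 fun j => c.2.count j)).sum =
          (l.length : ℝ) * dφ + ((l.map fun c => c.2.length).sum : ℕ) := by
      intro l
      induction l with
      | nil => simp
      | cons c l ih =>
          simp only [List.map_cons, List.sum_cons, List.length_cons, Function.comp_apply] at ih ⊢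
          rw [ih]
          simp only [ExpFactor.wtq, baseChangeFactor, sum_count_dir]
          push_cast
          ring
    exact h1 (rep C)
  have h0 : wt dφ ([] : List (Fin n × (Fin d → ℕ))) = 0 := by simp [wt]
  have hwt : wt dφ ([] : List (Fin n × (Fin d → ℕ))) + (L₂.map (ExpFactor.wtq dφ)).sum ≤ dplus := by
    rw [h0, heq, zero_add]; exact hdim
  have hval : ∀ q ∈ L₂, q.Valid a U := by
    intro q hq
    rw [hL₂, List.mem_map] at hq
    obtain ⟨c, _, rfl⟩ := hq
    exact baseChangeFactor_valid a w hU c.1 _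
  have h := TphiPairing_tensorTF_expand_eq_zero hA a hH hHU hzero L₂ [] hval hwt
  rw [List.map_nil, List.append_nil, ← hlist] at h
  unfold dualC dualTF TphiPairing
  rw [pairing_smul_right]
  unfold TphiPairing at h
  rw [h, mul_zero]

/-! ### Independence of `Loc_X F` from the base point (Proposition 1.3.1 (iii)) -/

/-- The pairing is additive under subtraction in `F`. [folklore] -/
theorem TphiPairing_sub {E : Type*} [NormedAddCommGroup E] [NormedSpace ℝ E] {Ξ : Type*} [Fintype Ξ]
    (pN : ℕ) (e : Ξ → E) {F G : E → ℝ} (hF : ContDiff ℝ ∞ F) (hG : ContDiff ℝ ∞ G) (φ : E) (g : List Ξ → ℝ) :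
    TphiPairing pN e (fun ψ => F ψ - G ψ) φ g = TphiPairing pN e F φ g - TphiPairing pN e G φ g := by
  have h : (fun ψ => F ψ - G ψ) = fun ψ => F ψ + (-1) * G ψ := by funext ψ; ring
  rw [h, TphiPairing_add pN e hF (contDiff_const.mul hG), TphiPairing_const_mul pN e hG]
  ring

/-- `Loc_X F` depends on `F` only through the row vector `α = (⟨F, f_C^{(a)}⟩_0)_C`. [folklore] -/
theorem locX_congr_of_alphaVec_eq (pN : ℕ) (dφ dplus : ℝ) (a : TorusSite d M) (X : Finset (TorusSite d M))
    {F G : (TorusSite d M → Fin n → ℝ) → ℝ} (h : alphaVec pN dφ dplus a F = alphaVec (n := n) pN dφ dplus a G) :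
    locX pN dφ dplus a X F = locX pN dφ dplus a X G := by
  unfold locX betaVec
  rw [h]

/-- **Proposition 1.3.1 (iii) of [BS-rg-loc]: `Loc_X F` does not depend on the base point of the
coordinate patch.** For `F ∈ 𝒩(U)` with `U` inside the common patch of `a` and `a' = a + w`, and
`U` containing the reach `⌊d_+⌋` of `X`, the operators built from the dual bases at `a` and at
`a'` agree: the element `V = Loc_X^{(a)}F ∈ 𝒱(X)` has the defining pairings also for the dual
basis at `a'` (span stability), so uniqueness at `a'` identifies it with `Loc_X^{(a')}F`.
[cite: BrydgesSlade2015RGII, Proposition 1.3.1 (iii) and its proof in §2.1] -/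
theorem locX_base_change {pN : ℕ} {dφ dplus : ℝ} (hA : LocAdm M n pN dφ dplus) {a : TorusSite d M}
    {w : Fin d → ℤ} {X U : Finset (TorusSite d M)} (hXne : X.Nonempty)
    (hX' : InPatch (offsetPtZ a w) ⌊dplus⌋₊ X) (hX : InPatch a ⌊dplus⌋₊ X)
    (hU : ∀ y ∈ U, ∀ j, 2 * |coord a y j - w j| < M) (hK : 2 * ((⌊dplus⌋₊ : ℤ) + 1) < M)
    (hXU : ∀ x ∈ X, reach x ⌊dplus⌋₊ ⊆ U)
    {F : (TorusSite d M → Fin n → ℝ) → ℝ} (hF : ContDiff ℝ ∞ F) (hFU : DependsOn U F) :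
    locX pN dφ dplus (offsetPtZ a w) X F = locX pN dφ dplus a X F := by
  set V := locX pN dφ dplus a X F with hV
  have hVs : ContDiff ℝ ∞ V := contDiff_locX pN dφ dplus a X F
  have hVU : DependsOn U V := dependsOn_locX hA.pos hK hXU a F
  -- `H = V - F` pairs to zero with the dual basis at `a`, hence at `a'`
  have hzero : ∀ C ∈ vPlus d n dφ dplus,
      TphiPairing pN (basisDir d M n) (fun ψ => V ψ - F ψ) 0 (dualC a C) = 0 := by
    intro C hC
    rw [TphiPairing_sub pN _ hVs hF]
    have := TphiPairing_locX_dualC hA hX hXne F ⟨C, hC⟩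
    rw [hV]; simp only [] at this ⊢; linarith
  have hzero' : ∀ C ∈ vPlus d n dφ dplus,
      TphiPairing pN (basisDir d M n) (fun ψ => V ψ - F ψ) 0 (dualC (offsetPtZ a w) C) = 0 :=
    fun C hC => TphiPairing_dualC_baseChange_eq_zero hA a w hU (hVs.sub hF)
      (fun φ ψ h => by simp only []; rw [hVU φ ψ h, hFU φ ψ h]) hzero hC
  -- hence `α^{(a')}(V) = α^{(a')}(F)` and `Loc^{(a')} F = Loc^{(a')} V = V`
  have hα : alphaVec pN dφ dplus (offsetPtZ a w) V = alphaVec (n := n) pN dφ dplus (offsetPtZ a w) F := by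
    funext C
    have h := hzero' C.1 C.2
    rw [TphiPairing_sub pN _ hVs hF] at h
    unfold alphaVec
    linarith
  rw [← locX_congr_of_alphaVec_eq pN dφ dplus (offsetPtZ a w) X hα, hV]
  exact locX_sum_phatX hA hX' hXne _

/-! ### Propositions 1.4.1 and 1.4.2, and `Loc_{X,Y}` (Definition 1.7.1) -/

/-- **Proposition 1.4.1 of [BS-rg-loc]**: `Loc_X ∘ Loc_{X'} = Loc_X` (the polynomial test functions
read `Loc_{X'}F` and `F` alike); here with both operators based at the same point `a` of a common
patch of `X` and `X'`. [cite: BrydgesSlade2015RGII, Proposition 1.4.1] -/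
theorem locX_locX' {pN : ℕ} {dφ dplus : ℝ} (hA : LocAdm M n pN dφ dplus) {a : TorusSite d M}
    (X : Finset (TorusSite d M)) {X' : Finset (TorusSite d M)} (hX' : InPatch a ⌊dplus⌋₊ X') (hX'ne : X'.Nonempty)
    (F : (TorusSite d M → Fin n → ℝ) → ℝ) :
    locX pN dφ dplus a X (locX pN dφ dplus a X' F) = locX pN dφ dplus a X F := by
  refine locX_congr_of_alphaVec_eq pN dφ dplus a X ?_
  funext C
  exact TphiPairing_locX_dualC hA hX' hX'ne F C

/-- `P̂_m(X) = Σ_{x ∈ X} P̂_m({x})`. [folklore] -/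
theorem phatX_eq_sum_singleton (m' : List (Fin n × List (Fin d))) (X : Finset (TorusSite d M)) :
    phatX m' X = fun φ => ∑ x ∈ X, phatX m' {x} φ := by
  funext φ; simp [phatX]

/-- **Proposition 1.4.2 of [BS-rg-loc] (additivity)**: if `P ∈ 𝒱` satisfies `Loc_{{x}}F_x = P_x`
for all `x ∈ X`, then `Loc_X(Σ_{x∈X}F_x) = P(X)`; here `P = Σ_C γ_C P̂_C`. [cite: BrydgesSlade2015RGII, Proposition 1.4.2] -/
theorem locX_sum_eq {pN : ℕ} {dφ dplus : ℝ} (hA : LocAdm M n pN dφ dplus) {a : TorusSite d M}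
    {X : Finset (TorusSite d M)} (hX : InPatch a ⌊dplus⌋₊ X) (hXne : X.Nonempty)
    (Fx : TorusSite d M → (TorusSite d M → Fin n → ℝ) → ℝ) (hFx : ∀ x ∈ X, ContDiff ℝ ∞ (Fx x))
    (γ : vPlus d n dφ dplus → ℝ)
    (hloc : ∀ x ∈ X, locX pN dφ dplus a {x} (Fx x) = fun φ => ∑ C : vPlus d n dφ dplus, γ C * phatX (rep C.1) {x} φ) :
    locX pN dφ dplus a X (fun φ => ∑ x ∈ X, Fx x φ) =
      fun φ => ∑ C : vPlus d n dφ dplus, γ C * phatX (rep C.1) X φ := by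
  have hrhs := locX_sum_phatX hA hX hXne γ
  rw [← hrhs]
  refine locX_congr_of_alphaVec_eq pN dφ dplus a X ?_
  funext C
  unfold alphaVec
  rw [TphiPairing_finset_sum pN _ X (F := fun x ψ => Fx x ψ) hFx]
  -- each `⟨F_x, f_C⟩_0 = ⟨Loc_{{x}}F_x, f_C⟩_0 = ⟨Σ_C' γ_C' P̂_C'({x}), f_C⟩_0`
  have hx : ∀ x ∈ X, TphiPairing pN (basisDir d M n) (Fx x) 0 (dualC a C.1) =
      TphiPairing pN (basisDir d M n) (fun φ => ∑ C' : vPlus d n dφ dplus, γ C' * phatX (rep C'.1) {x} φ) 0 (dualC a C.1) := by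
    intro x hxX
    have hsing : InPatch a ⌊dplus⌋₊ {x} := fun y hy => hX y (by rw [Finset.mem_singleton.1 hy]; exact hxX)
    rw [← hloc x hxX, TphiPairing_locX_dualC hA hsing ⟨x, Finset.mem_singleton_self x⟩ (Fx x) C]
  rw [Finset.sum_congr rfl hx]
  rw [← TphiPairing_finset_sum pN _ X
    (F := fun x ψ => ∑ C' : vPlus d n dφ dplus, γ C' * phatX (rep C'.1) {x} ψ)
    (fun x _ => ContDiff.sum fun C' _ => contDiff_const.mul (contDiff_phatX _ _))]
  congr 1
  funext ψ
  rw [Finset.sum_comm]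
  refine Finset.sum_congr rfl fun C' _ => ?_
  rw [phatX_eq_sum_singleton (rep C'.1) X, Finset.mul_sum]

/-- **Definition 1.7.1 of [BS-rg-loc]**: `Loc_{X,Y}F = P_X(Y)` where `P_X ∈ 𝒱` is determined by
`P_X(X) = Loc_X F` ("evaluates the polynomial `Loc_X F` on the set `Y` rather than on `X`").
[cite: BrydgesSlade2015RGII, Definition 1.7.1] -/
def locXY (pN : ℕ) (dφ dplus : ℝ) (a : TorusSite d M) (X Y : Finset (TorusSite d M))
    (F : (TorusSite d M → Fin n → ℝ) → ℝ) : (TorusSite d M → Fin n → ℝ) → ℝ :=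
  fun φ => ∑ C : vPlus d n dφ dplus, betaVec pN dφ dplus a X F C * phatX (rep C.1) Y φ

/-- `Loc_{X,X} = Loc_X`. [cite: BrydgesSlade2015RGII, §1.7 (sentence after Definition 1.7.1)] -/
theorem locXY_self (pN : ℕ) (dφ dplus : ℝ) (a : TorusSite d M) (X : Finset (TorusSite d M))
    (F : (TorusSite d M → Fin n → ℝ) → ℝ) : locXY pN dφ dplus a X X F = locX pN dφ dplus a X F := rfl

/-- **`Loc_X = Σ_i Loc_{X,X_i}` for a partition `{X_1,…,X_m}` of `X`** (display (1.39) area of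
[BS-rg-loc]); here for the partition of `X` into the blocks of a function `b : X → β`, in the form
`Loc_{X,X} = Σ_{k} Loc_{X, b⁻¹(k)}`, and in particular `Loc_X = Σ_{x∈X} Loc_{X,{x}}`. [cite: BrydgesSlade2015RGII, §1.7 (display after Definition 1.7.1)] -/
theorem locX_eq_sum_locXY_singleton (pN : ℕ) (dφ dplus : ℝ) (a : TorusSite d M) (X : Finset (TorusSite d M))
    (F : (TorusSite d M → Fin n → ℝ) → ℝ) :
    locX pN dφ dplus a X F = fun φ => ∑ x ∈ X, locXY pN dφ dplus a X {x} F φ := by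
  funext φ
  unfold locX locXY
  rw [Finset.sum_comm]
  refine Finset.sum_congr rfl fun C _ => ?_
  rw [phatX_eq_sum_singleton (rep C.1) X, Finset.mul_sum]

/-- `Loc_{X,Y}` is additive in `Y` over disjoint unions. [cite: BrydgesSlade2015RGII, §1.7 (display after Definition 1.7.1)] -/
theorem locXY_union (pN : ℕ) (dφ dplus : ℝ) (a : TorusSite d M) (X : Finset (TorusSite d M)) {Y Y' : Finset (TorusSite d M)}
    (h : Disjoint Y Y') (F : (TorusSite d M → Fin n → ℝ) → ℝ) :
    locXY pN dφ dplus a X (Y ∪ Y') F = fun φ => locXY pN dφ dplus a X Y F φ + locXY pN dφ dplus a X Y' F φ := by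
  funext φ
  unfold locXY phatX
  rw [← Finset.sum_add_distrib]
  refine Finset.sum_congr rfl fun C _ => ?_
  rw [Finset.sum_union h, mul_add]

end Loc

end LongRangePhi4

end Literature.Barriers.CriticalPhenomena

end
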